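import Mathlib.CategoryTheory.CofilteredSystem
import Literature.AnabelianGeometry.SemiGraphs.FreeGroupsAndActionsProofs4

/-!
# Compatible fixed vertices in an inverse system of trees ([SemiAnbd] Thm. 3.7 (iii), p. 41)

Mochizuki, *Semi-graphs of Anabelioids*, Publ. RIMS **42** (2006) 221–322, §3, author's manuscript
pp. 40–41 [cite: MochizukiSemiAnbd2006, Thm. 3.7(iii) pp.40-41].  The tree-combinatorial core of
the proof of Theorem 3.7 (iii) ("every compact subgroup of `π₁^temp(𝒢)` is contained in at least one
verticial subgroup"), isolated as statements about semi-graphs (no anabelioids, no topology):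

* `exists_fixed_vertex_or_edge_of_finite_range` — a group acting on a tree through a FINITE
  quotient fixes a vertex or an edge (Lemma 1.8 (ii)(a), `lemma_1_8_ii_a_holds`, applied to the
  image);
* `exists_fixed_vertex_of_noSwap` — if moreover every edge abuts to some vertex and no group
  element switches the two branches of an edge it fixes ("since the action of `H` is over `𝒢`, it
  follows that if `H` fixes an edge, then it does not switch the branches of the edge … every edge
  of `𝒢_{∞,i}` abuts to at least one vertex … `H` always fixes at least one vertex", p. 41), then
  the group fixes a VERTEX;
* `exists_compatible_of_finite` — Kőnig / compactness: an inverse system, over a directed index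
  order, of FINITE nonempty subsets stable under the transition maps has a compatible family of
  elements (Mathlib's `nonempty_sections_of_finite_inverse_system`, unbundled);
* `exists_compatible_fixed_vertices` — the combination: a directed inverse system of trees `T_j`
  with equivariant actions of one group `C` through finite quotients, every edge abutting, no
  branch switching, and FINITELY many fixed vertices at each level ("by possibly replacing `J` by
  some smaller cofinal subset, we may assume that there exists a compatible system of vertices of
  `𝒢_{∞,j}`, for `j ∈ J`, each of which is fixed by `H`", p. 41) has a compatible system of fixed
  vertices; `exists_compatible_fixed_vertices_eventually` is the same from a level `j₀` on.

The finiteness of the fixed-vertex sets is an explicit hypothesis: in the proof of Theorem 3.7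
(iii) it comes, for a nontrivial compact subgroup, from the bound "at most two fixed vertices"
(Lemma 1.8 (ii)(b),(c) and total estrangement) — not from the tree combinatorics.  Consumers:
`CompactInVerticial` (both conjuncts), Proposition 3.6 (iii).
-/

namespace Literature.AnabelianGeometry.SemiGraphs

namespace SemiGraph

open CategoryTheory

universe u v w

/-! ### One level: a finite quotient acting on a tree -/

/-- A group acting on a tree through a finite quotient (finite image in `Aut G`) fixes a vertex or
an edge — Lemma 1.8 (ii)(a) for the image. [cite: MochizukiSemiAnbd2006, Thm. 3.7(iii) p.41] -/
theorem exists_fixed_vertex_or_edge_of_finite_range {G : SemiGraph.{u}} (hT : G.IsTree)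
    {C : Type w} [Group C] (ρ : C →* Aut G) (hfin : (Set.range ρ).Finite) :
    (∃ v : G.Vertex, ∀ c : C, (ρ c).hom.vertexMap v = v) ∨
      ∃ e : G.Edge, ∀ c : C, (ρ c).hom.edgeMap e = e := by
  haveI : Finite ρ.range := hfin.to_subtype
  rcases lemma_1_8_ii_a_holds G ρ.range ρ.range.subtype hT with ⟨v, hv⟩ | ⟨e, he⟩
  · exact Or.inl ⟨v, fun c => hv ⟨ρ c, c, rfl⟩⟩
  · exact Or.inr ⟨e, fun c => he ⟨ρ c, c, rfl⟩⟩

/-- A group acting on a tree through a finite quotient, WITHOUT switching the branches of any edge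
it fixes, on a tree all of whose edges abut to some vertex, fixes a vertex: a fixed edge has a
fixed abutting branch, whose vertex is then fixed. [cite: MochizukiSemiAnbd2006, Thm. 3.7(iii) p.41] -/
theorem exists_fixed_vertex_of_noSwap {G : SemiGraph.{u}} (hT : G.IsTree)
    (habut : ∀ e : G.Edge, ∃ b : G.Branch, G.edgeOf b = e ∧ (G.abuts b).isSome)
    {C : Type w} [Group C] (ρ : C →* Aut G) (hfin : (Set.range ρ).Finite)
    (hnoswap : ∀ (c : C) (b : G.Branch), (ρ c).hom.edgeMap (G.edgeOf b) = G.edgeOf b →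
      (ρ c).hom.branchMap b = b) :
    ∃ v : G.Vertex, ∀ c : C, (ρ c).hom.vertexMap v = v := by
  rcases exists_fixed_vertex_or_edge_of_finite_range hT ρ hfin with h | ⟨e, he⟩
  · exact h
  · obtain ⟨b, hbe, hb⟩ := habut e
    obtain ⟨v, hv⟩ := Option.isSome_iff_exists.mp hb
    refine ⟨v, fun c => ?_⟩
    have hbb : (ρ c).hom.branchMap b = b := hnoswap c b (by rw [hbe]; exact he c)
    have h1 := (ρ c).hom.abuts_branchMap b v hv
    rw [hbb, hv] at h1
    exact (Option.some.inj h1).symm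

/-! ### Compatible families in inverse systems of finite sets -/

/-- **Kőnig / compactness for inverse systems of finite sets**, unbundled from Mathlib's
`nonempty_sections_of_finite_inverse_system`: over a directed index order, finite nonempty subsets
`F j ⊆ X j` stable under functorial transition maps `X j → X i` (`i ≤ j`) admit a compatible family
of elements. [cite: MochizukiSemiAnbd2006, Thm. 3.7(iii) p.41] -/
theorem exists_compatible_of_finite {J : Type u} [Preorder J] [IsDirectedOrder J]
    {X : J → Type v} (f : ∀ ⦃i j : J⦄, i ≤ j → X j → X i)
    (f_id : ∀ (i : J) (x : X i), f le_rfl x = x)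
    (f_comp : ∀ ⦃i j k : J⦄ (hij : i ≤ j) (hjk : j ≤ k) (x : X k), f hij (f hjk x) = f (hij.trans hjk) x)
    (F : ∀ j, Set (X j)) (hfin : ∀ j, (F j).Finite) (hne : ∀ j, (F j).Nonempty)
    (hmap : ∀ ⦃i j : J⦄ (h : i ≤ j) (x : X j), x ∈ F j → f h x ∈ F i) :
    ∃ x : ∀ j, X j, (∀ j, x j ∈ F j) ∧ ∀ ⦃i j : J⦄ (h : i ≤ j), f h (x j) = x i := by
  let D : Jᵒᵖ ⥤ Type v :=
    { obj := fun j => F j.unop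
      map := fun {a b} h => TypeCat.ofHom fun x => ⟨f (leOfHom h.unop) x.1, hmap _ _ x.2⟩
      map_id := fun a => ConcreteCategory.hom_ext _ _ fun x => Subtype.ext (f_id _ _)
      map_comp := fun {a b c} h h' =>
        ConcreteCategory.hom_ext _ _ fun x => Subtype.ext (f_comp _ _ _).symm }
  haveI : ∀ j : Jᵒᵖ, Finite (D.obj j) := fun j => (hfin j.unop).to_subtype
  haveI : ∀ j : Jᵒᵖ, Nonempty (D.obj j) := fun j => (hne j.unop).to_subtype
  obtain ⟨s, hs⟩ := nonempty_sections_of_finite_inverse_system D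
  refine ⟨fun j => (s (Opposite.op j)).1, fun j => (s (Opposite.op j)).2, fun i j h => ?_⟩
  have h1 : D.map ((homOfLE h).op) (s (Opposite.op j)) = s (Opposite.op i) :=
    @hs (Opposite.op j) (Opposite.op i) (homOfLE h).op
  exact congrArg Subtype.val h1

/-! ### Inverse systems of trees with actions through finite quotients -/

/-- **Compatible fixed vertices.**  Let `(T_j)_{j ∈ J}` be trees indexed by a directed order, with
vertex-level transition maps `T_j → T_i` (`i ≤ j`, functorial), each carrying an action of one group
`C` through a finite quotient, equivariantly, such that every edge abuts to a vertex and no element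
switches the branches of an edge it fixes.  If at every level the set of `C`-fixed vertices is
FINITE, there is a compatible family of `C`-fixed vertices.  (Proof of Thm. 3.7 (iii), p. 41:
Lemma 1.8 (ii)(a) at each level, then "we may choose a compatible system"; the finiteness is the
bound "no more than two vertices" established there from total estrangement.)
[cite: MochizukiSemiAnbd2006, Thm. 3.7(iii) p.41] -/
theorem exists_compatible_fixed_vertices {J : Type v} [Preorder J] [IsDirectedOrder J]
    (T : J → SemiGraph.{u}) (hT : ∀ j, (T j).IsTree)
    (habut : ∀ (j : J) (e : (T j).Edge), ∃ b : (T j).Branch, (T j).edgeOf b = e ∧ ((T j).abuts b).isSome)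
    {C : Type w} [Group C] (ρ : ∀ j, C →* Aut (T j)) (hfin : ∀ j, (Set.range (ρ j)).Finite)
    (hnoswap : ∀ (j : J) (c : C) (b : (T j).Branch),
      (ρ j c).hom.edgeMap ((T j).edgeOf b) = (T j).edgeOf b → (ρ j c).hom.branchMap b = b)
    (π : ∀ ⦃i j : J⦄, i ≤ j → (T j).Vertex → (T i).Vertex)
    (π_id : ∀ (j : J) (x : (T j).Vertex), π le_rfl x = x)
    (π_comp : ∀ ⦃i j k : J⦄ (hij : i ≤ j) (hjk : j ≤ k) (x : (T k).Vertex),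
      π hij (π hjk x) = π (hij.trans hjk) x)
    (hequiv : ∀ ⦃i j : J⦄ (h : i ≤ j) (c : C) (x : (T j).Vertex),
      π h ((ρ j c).hom.vertexMap x) = (ρ i c).hom.vertexMap (π h x))
    (hfixfin : ∀ j, {x : (T j).Vertex | ∀ c : C, (ρ j c).hom.vertexMap x = x}.Finite) :
    ∃ x : ∀ j, (T j).Vertex, (∀ (j : J) (c : C), (ρ j c).hom.vertexMap (x j) = x j) ∧
      ∀ ⦃i j : J⦄ (h : i ≤ j), π h (x j) = x i := by
  have hne : ∀ j, {x : (T j).Vertex | ∀ c : C, (ρ j c).hom.vertexMap x = x}.Nonempty :=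
    fun j => exists_fixed_vertex_of_noSwap (hT j) (habut j) (ρ j) (hfin j) (hnoswap j)
  have hmap : ∀ ⦃i j : J⦄ (h : i ≤ j) (x : (T j).Vertex),
      x ∈ {x : (T j).Vertex | ∀ c : C, (ρ j c).hom.vertexMap x = x} →
        π h x ∈ {x : (T i).Vertex | ∀ c : C, (ρ i c).hom.vertexMap x = x} := by
    intro i j h x hx c
    rw [← hequiv h c x, hx c]
  obtain ⟨x, hx, hcompat⟩ := exists_compatible_of_finite π π_id π_comp _ hfixfin hne hmap
  exact ⟨x, fun j c => hx j c, hcompat⟩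

/-- The same from a level `j₀` on: if the fixed-vertex sets are finite for all `j ≥ j₀`, there is a
compatible family of fixed vertices indexed by `{j // j₀ ≤ j}` ("by possibly replacing `J` by some
smaller cofinal subset", p. 41). [cite: MochizukiSemiAnbd2006, Thm. 3.7(iii) p.41] -/
theorem exists_compatible_fixed_vertices_eventually {J : Type v} [Preorder J] [IsDirectedOrder J]
    (T : J → SemiGraph.{u}) (hT : ∀ j, (T j).IsTree)
    (habut : ∀ (j : J) (e : (T j).Edge), ∃ b : (T j).Branch, (T j).edgeOf b = e ∧ ((T j).abuts b).isSome)
    {C : Type w} [Group C] (ρ : ∀ j, C →* Aut (T j)) (hfin : ∀ j, (Set.range (ρ j)).Finite)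
    (hnoswap : ∀ (j : J) (c : C) (b : (T j).Branch),
      (ρ j c).hom.edgeMap ((T j).edgeOf b) = (T j).edgeOf b → (ρ j c).hom.branchMap b = b)
    (π : ∀ ⦃i j : J⦄, i ≤ j → (T j).Vertex → (T i).Vertex)
    (π_id : ∀ (j : J) (x : (T j).Vertex), π le_rfl x = x)
    (π_comp : ∀ ⦃i j k : J⦄ (hij : i ≤ j) (hjk : j ≤ k) (x : (T k).Vertex),
      π hij (π hjk x) = π (hij.trans hjk) x)
    (hequiv : ∀ ⦃i j : J⦄ (h : i ≤ j) (c : C) (x : (T j).Vertex),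
      π h ((ρ j c).hom.vertexMap x) = (ρ i c).hom.vertexMap (π h x))
    (j₀ : J)
    (hfixfin : ∀ j, j₀ ≤ j → {x : (T j).Vertex | ∀ c : C, (ρ j c).hom.vertexMap x = x}.Finite) :
    ∃ x : ∀ j : {j : J // j₀ ≤ j}, (T j.1).Vertex,
      (∀ (j : {j : J // j₀ ≤ j}) (c : C), (ρ j.1 c).hom.vertexMap (x j) = x j) ∧
      ∀ ⦃i j : {j : J // j₀ ≤ j}⦄ (h : i.1 ≤ j.1), π h (x j) = x i := by
  haveI : IsDirectedOrder {j : J // j₀ ≤ j} := by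
    refine ⟨fun a b => ?_⟩
    obtain ⟨c, hac, hbc⟩ := exists_ge_ge a.1 b.1
    exact ⟨⟨c, a.2.trans hac⟩, hac, hbc⟩
  obtain ⟨x, hx, hcompat⟩ := exists_compatible_fixed_vertices (J := {j : J // j₀ ≤ j})
    (fun j => T j.1) (fun j => hT j.1) (fun j => habut j.1) (fun j => ρ j.1) (fun j => hfin j.1)
    (fun j => hnoswap j.1) (fun i j (h : i ≤ j) => π (show i.1 ≤ j.1 from h))
    (fun j x => π_id j.1 x) (fun i j k hij hjk x => π_comp _ _ x) (fun i j h c x => hequiv _ c x)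
    (fun j => hfixfin j.1 j.2)
  exact ⟨x, hx, fun i j h => hcompat (show i ≤ j from h)⟩

end SemiGraph

end Literature.AnabelianGeometry.SemiGraphs
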